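import Summits.QuantumFields.BalabanUV.T4Continuum.Support.CovariantBlockAveraging

/-!
# T⁴ programme, spine node NE2 (U1a) — R14 W1, file 1: THE COVARIANT BLOCK AVERAGING WITH AN ARBITRARY TRANSPORTER TABLE `Q_k(T)`, and its size law
# (cell `pub-balaban-gaps`, seat ne2 gen 3; plan `run/shared/lean/pub/pub-balaban-gaps/ne/NE2-R14-PLAN.md` W1; residual r2 of the dictionary B0)

Row B3's `Support/CovariantBlockAveraging.Qcov Γ R` reads the colour transporter of the fine bond `[x + te_μ, x + (t+1)e_μ]` of the block of the coarse bond `(y, μ)` as the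
PRODUCT `transport R μ (Γ y j μ t)` of ONE bond field `R` along ONE contour.  Print's averaging in [B9] (3.15) p. 393 is the COMPOSITION `Q_k(U) = Q(Ū^{(k−1)}) ⋯ Q(Ū)Q(U)`
of one-step averagings ([B7] (124)/(125) p. 36), whose transporter on the `i`-th leg is the `i`-FOLD AVERAGED field — not a product of fine bond variables; and (124) carries
further O(L²α₀) terms.  Both are instances of ONE shape: a block line-sum with an ARBITRARY TRANSPORTER TABLE
  `(Q_k(T)A)_μ(y) = n^{−(d+1)} Σ_{j} Σ_{t<n} T(y, j, μ, t)·A_μ(ny + j + te_μ)`  (**`QcovT n M T`**, `T : Tor M → (Fin d → Fin n) → Fin d → ℕ → Matrix o o ℂ`),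
with **`QcovT_transport`**: `Qcov Γ R = QcovT (fun y j μ t => transport R μ (Γ y j μ t))` (`rfl`).  THIS FILE re-runs §4 of `CovariantBlockAveraging` for the table:
`QcovT_const_one` (`T ≡ 1` gives `Q_k ⊗ 1`), the entries of the transport error `QcovT_sub_kron_apply`, the ENTRY LAW `norm_QcovT_sub_kron_apply_le` from
`‖T(y,j,μ,t) − 1‖ ≤ τ`, and the SIZE LAW **`opNorm_QcovT_sub_kron_le : ‖Q_k(T) − Q_k ⊗ 1‖ ≤ card o · τ · (√(n^d))⁻¹`** (rectangular Schur test with `qr`'s row sums `1` and column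
sums `n^{−d}`) — the proofs are those of row B3 verbatim with `transport R μ (Γ …)` replaced by `T …` (they never used anything else).  Files 2–3 of W1 (the two-level pairing
`pairD`/`pairing_apply`/`opNorm_pairing_le` and the tower packaging `QcovLevT`/`EcovT`/`averagingLaws_EcovT` with the table's size `hTτ` and two-level consistency `hT2` as
DISPLAYED binders) and W2 (Bałaban's composed table from a data tower of coarse fields) are the successor's.
HONEST FRAMING (T4-DAG p. 1).  A TYPED OPERATOR SHAPE and bookkeeping about it; `T` is DATA; nothing of [B7] (124)/(15) is constructed (DIVERGENCE F6 (ζ) of `pub-balaban`);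
nothing printed is a hypothesis or a conclusion; NOT NE2, NOT [B9] (3.16)/(3.26) as printed; NE2 (U1a) NOT PROVED; spine PROVED 0/9 unchanged; NOT continuum YM / infinite volume /
mass gap / Clay.  HONEST DEPENDENCY: continuum YM on T⁴ ⇐ BetaPertH ∧ nine spine estimates (0/9 proved); BetaPertH ⇐ (D1) ∧ (D4) ∧ CAP+tail; G-an2-4 gates asym, D1 and
NE2/3/4.  No `sorry`.
-/

noncomputable section

open scoped BigOperators ComplexConjugate Matrix Matrix.Norms.L2Operator Kronecker

namespace Summit.QuantumFields.BalabanUV.T4Continuum.NE2.CovariantTableAveraging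

open Literature.MathematicalPhysics.QuantumFieldTheory.Balaban1983to89.B5Prop11Plancherel (Tor fine unitVec)
open Literature.MathematicalPhysics.QuantumFieldTheory.Balaban1983to89.B5Block118 (QvOp bpt tstep)
open Literature.MathematicalPhysics.QuantumFieldTheory.Balaban1983to89.Beta.DeltaACombesThomas (qr qr_nonneg norm_QvOp_le sum_qr_row sum_qr_col)
open Summit.QuantumFields.BalabanUV.T4Continuum.BalabanAveragedTowerUnit (norm_entry_le_opNorm)
open Summit.QuantumFields.BalabanUV.T4Continuum.CovariantBlockAveraging (transport ContourSystem Qcov opNorm_le_sqrt_of_schur)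

variable {d : ℕ} (n : ℕ) [NeZero n] (M : Fin d → ℕ) [hM : ∀ μ, NeZero (M μ)] {o : Type*} [Fintype o] [DecidableEq o]

/-- a TRANSPORTER TABLE: one colour matrix per (coarse bond base `y`, block offset `j`, direction `μ`, position `t` on the line). [folklore] -/
abbrev Table (d n : ℕ) (M : Fin d → ℕ) (o : Type*) := Tor M → (Fin d → Fin n) → Fin d → ℕ → Matrix o o ℂ

/-- **THE COVARIANT k-FOLD BLOCK AVERAGING WITH AN ARBITRARY TRANSPORTER TABLE** `Q_k(T)`:
`(Q_k(T)A)_μ(y) = n^{−(d+1)} Σ_{j∈{0..n−1}^d} Σ_{t<n} T(y,j,μ,t)·A_μ(ny + j + te_μ)` — the common shape of the model's `Qcov Γ R` and of print's composed averaging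
[B9] (3.15) / [B7] (125). [cite: Balaban1985BackgroundPropagators, (3.14)–(3.15) p.393; Balaban1984PropagatorsI, (1.18) p.20 (shape)] [folklore] -/
def QcovT (T : Table d n M o) : Matrix ((Tor M × Fin d) × o) ((Tor (fine n M) × Fin d) × o) ℂ :=
  fun b i => if i.1.2 = b.1.2 then
      ∑ j : Fin d → Fin n, ∑ t : Fin n,
        (if i.1.1 = bpt n M b.1.1 j + tstep (fine n M) b.1.2 t then (1 / (n : ℂ) ^ (d + 1)) * T b.1.1 j b.1.2 t b.2 i.2 else 0)
    else 0

omit [NeZero n] hM in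
/-- **ROW B3's `Qcov` IS THE TABLE OPERATOR OF THE CONTOUR TRANSPORTERS** (definitional). [folklore] -/
theorem QcovT_transport (Γ : ContourSystem d n M) (R : Fin d → (Tor (fine n M) × Fin d → Matrix o o ℂ)) :
    Qcov n M Γ R = QcovT n M (fun y j μ t => transport (fine n M) R μ (Γ y j μ t)) := rfl

omit [NeZero n] hM [Fintype o] in
/-- **AT THE TRIVIAL TABLE `T ≡ 1` THE OPERATOR IS `Q_k ⊗ 1`**. [folklore] -/
theorem QcovT_const_one : QcovT n M (fun _ _ _ _ => (1 : Matrix o o ℂ)) = QvOp n M ⊗ₖ (1 : Matrix o o ℂ) := by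
  ext ⟨b, α⟩ ⟨i, α'⟩
  simp only [QcovT, Matrix.kroneckerMap_apply, QvOp]
  by_cases h : i.2 = b.2
  · rw [if_pos h, if_pos h, Finset.sum_mul]
    refine Finset.sum_congr rfl fun j _ => ?_
    rw [Finset.sum_mul]
    refine Finset.sum_congr rfl fun t _ => ?_
    split_ifs <;> simp
  · rw [if_neg h, if_neg h, zero_mul]

omit [NeZero n] hM [Fintype o] in
/-- the entries of the TRANSPORT ERROR `Q_k(T) − Q_k ⊗ 1`. [folklore] -/
theorem QcovT_sub_kron_apply (T : Table d n M o) (b : (Tor M × Fin d) × o) (i : (Tor (fine n M) × Fin d) × o) :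
    (QcovT n M T - QvOp n M ⊗ₖ (1 : Matrix o o ℂ)) b i
      = if i.1.2 = b.1.2 then
          ∑ j : Fin d → Fin n, ∑ t : Fin n,
            (if i.1.1 = bpt n M b.1.1 j + tstep (fine n M) b.1.2 t then (1 / (n : ℂ) ^ (d + 1)) * (T b.1.1 j b.1.2 t - 1) b.2 i.2 else 0)
        else 0 := by
  rw [← QcovT_const_one n M, Matrix.sub_apply]
  simp only [QcovT]
  by_cases h : i.1.2 = b.1.2
  · rw [if_pos h, if_pos h, if_pos h, ← Finset.sum_sub_distrib]
    refine Finset.sum_congr rfl fun j _ => ?_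
    rw [← Finset.sum_sub_distrib]
    refine Finset.sum_congr rfl fun t _ => ?_
    split_ifs
    · rw [Matrix.sub_apply, mul_sub]
    · rw [sub_zero]
  · rw [if_neg h, if_neg h, if_neg h, sub_zero]

omit [NeZero n] hM in
/-- **ENTRY LAW**: if every table entry is within `τ` of the identity, the `((b,α),(i,α′))` entry of the transport error is at most `τ·qr(b, i)`. [folklore] -/
theorem norm_QcovT_sub_kron_apply_le {T : Table d n M o} {τ : ℝ} (hτ : 0 ≤ τ) (hT : ∀ y j μ (t : Fin n), ‖T y j μ t - 1‖ ≤ τ)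
    (b : (Tor M × Fin d) × o) (i : (Tor (fine n M) × Fin d) × o) :
    ‖(QcovT n M T - QvOp n M ⊗ₖ (1 : Matrix o o ℂ)) b i‖ ≤ τ * qr n M b.1 i.1 := by
  rw [QcovT_sub_kron_apply]
  by_cases h : i.1.2 = b.1.2
  · rw [if_pos h]
    have hqr : qr n M b.1 i.1 = ∑ j : Fin d → Fin n, ∑ t : Fin n,
        (if i.1.1 = bpt n M b.1.1 j + tstep (fine n M) b.1.2 t then 1 / (n : ℝ) ^ (d + 1) else 0) := by
      rw [qr]
      refine Finset.sum_congr rfl fun j _ => Finset.sum_congr rfl fun t _ => ?_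
      have hiff : i.1 = (bpt n M b.1.1 j + tstep (fine n M) b.1.2 t, b.1.2) ↔ i.1.1 = bpt n M b.1.1 j + tstep (fine n M) b.1.2 t :=
        ⟨fun hi => by rw [hi], fun hi => Prod.ext hi h⟩
      by_cases hc : i.1.1 = bpt n M b.1.1 j + tstep (fine n M) b.1.2 t
      · rw [if_pos hc, if_pos (hiff.mpr hc)]
      · rw [if_neg hc, if_neg (fun h' => hc (hiff.mp h'))]
    rw [hqr, Finset.mul_sum]
    refine (norm_sum_le _ _).trans (Finset.sum_le_sum fun j _ => ?_)
    rw [Finset.mul_sum]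
    refine (norm_sum_le _ _).trans (Finset.sum_le_sum fun t _ => ?_)
    split_ifs
    · rw [norm_mul, norm_div, norm_one, norm_pow, Complex.norm_natCast, mul_comm]
      exact mul_le_mul_of_nonneg_right ((norm_entry_le_opNorm _ _ _).trans (hT _ _ _ _)) (by positivity)
    · simp
  · rw [if_neg h, norm_zero]
    exact mul_nonneg hτ (qr_nonneg n M b.1 i.1)

/-- **THE SIZE LAW (operator norm)**: `‖Q_k(T) − Q_k ⊗ 1‖ ≤ card o · τ · (√(n^d))⁻¹` from `‖T − 1‖ ≤ τ` entrywise — the (H-bd) input of the averaging summand's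
`PerturbationLaws` for ANY transporter table (row B3's `opNorm_Qcov_sub_kron_le` is the instance `T = transport R μ (Γ …)`). [folklore] -/
theorem opNorm_QcovT_sub_kron_le {T : Table d n M o} {τ : ℝ} (hτ : 0 ≤ τ) (hT : ∀ y j μ (t : Fin n), ‖T y j μ t - 1‖ ≤ τ) :
    ‖QcovT n M T - QvOp n M ⊗ₖ (1 : Matrix o o ℂ)‖ ≤ Fintype.card o * τ * (Real.sqrt ((n : ℝ) ^ d))⁻¹ := by
  have hn : (0 : ℝ) < (n : ℝ) ^ d := pow_pos (by exact_mod_cast Nat.pos_of_ne_zero (NeZero.ne n)) d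
  have hco : (0 : ℝ) ≤ Fintype.card o := Nat.cast_nonneg _
  have hrow : ∀ b : (Tor M × Fin d) × o, ∑ i : (Tor (fine n M) × Fin d) × o,
      ‖(QcovT n M T - QvOp n M ⊗ₖ (1 : Matrix o o ℂ)) b i‖ ≤ Fintype.card o * τ := by
    intro b
    calc _ ≤ ∑ i : (Tor (fine n M) × Fin d) × o, τ * qr n M b.1 i.1 :=
          Finset.sum_le_sum fun i _ => norm_QcovT_sub_kron_apply_le n M hτ hT b i
      _ = Fintype.card o * τ := by
          rw [Fintype.sum_prod_type, Finset.sum_comm]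
          simp only [Finset.sum_const, Finset.card_univ, nsmul_eq_mul, ← Finset.mul_sum]
          rw [sum_qr_row, mul_one]
  have hcol : ∀ i : (Tor (fine n M) × Fin d) × o, ∑ b : (Tor M × Fin d) × o,
      ‖(QcovT n M T - QvOp n M ⊗ₖ (1 : Matrix o o ℂ)) b i‖ ≤ Fintype.card o * τ * (1 / (n : ℝ) ^ d) := by
    intro i
    calc _ ≤ ∑ b : (Tor M × Fin d) × o, τ * qr n M b.1 i.1 :=
          Finset.sum_le_sum fun b _ => norm_QcovT_sub_kron_apply_le n M hτ hT b i
      _ = Fintype.card o * τ * (1 / (n : ℝ) ^ d) := by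
          rw [Fintype.sum_prod_type, Finset.sum_comm]
          simp only [Finset.sum_const, Finset.card_univ, nsmul_eq_mul, ← Finset.mul_sum]
          rw [sum_qr_col, mul_assoc]
  refine (opNorm_le_sqrt_of_schur _ (by positivity) (by positivity) hrow hcol).trans (le_of_eq ?_)
  rw [show (Fintype.card o : ℝ) * τ * (Fintype.card o * τ * (1 / (n : ℝ) ^ d)) = (Fintype.card o * τ) ^ 2 * ((n : ℝ) ^ d)⁻¹ by ring,
    Real.sqrt_mul (sq_nonneg _), Real.sqrt_sq (by positivity), Real.sqrt_inv]

omit [NeZero n] hM in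
/-- **TABLES COMPOSE**: the entrywise product of two tables (e.g. `T_Bal = T_coarse · T_fine` along a composite contour) is within `(1+τ₁)(1+τ₂) − 1` of the identity when the
factors are within `τ₁`, `τ₂` — the bookkeeping W2 uses leg by leg. [folklore] -/
theorem norm_mul_sub_one_le {A B : Matrix o o ℂ} {τ₁ τ₂ : ℝ} (hA : ‖A - 1‖ ≤ τ₁) (hB : ‖B - 1‖ ≤ τ₂) :
    ‖A * B - 1‖ ≤ (1 + τ₁) * (1 + τ₂) - 1 := by
  have h0 : 0 ≤ τ₁ := (norm_nonneg _).trans hA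
  have e : A * B - 1 = (A - 1) * (B - 1) + (A - 1) + (B - 1) := by noncomm_ring
  rw [e]
  calc ‖(A - 1) * (B - 1) + (A - 1) + (B - 1)‖ ≤ ‖A - 1‖ * ‖B - 1‖ + ‖A - 1‖ + ‖B - 1‖ :=
        (norm_add₃_le).trans (add_le_add (add_le_add (norm_mul_le _ _) le_rfl) le_rfl)
    _ ≤ τ₁ * τ₂ + τ₁ + τ₂ := by gcongr
    _ = (1 + τ₁) * (1 + τ₂) - 1 := by ring

end Summit.QuantumFields.BalabanUV.T4Continuum.NE2.CovariantTableAveraging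

end
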